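import Summits.QuantumAdvantage.QuantumAdvantage.Theorems.CharDialPartyDialC

/-!
# PartyDial (decomp-qadv lens-5 g35), part D — §3: the laws (two blocks 8/9, four blocks 2/3 given `Best4Le`) and the pieces of `CharDial.FrobHardOdd`

See part A (`CharDialPartyDialA`) for the node header; memo `NODE-g35.md` (g35 folder of decomp-qadv-lens-5).
-/

set_option autoImplicit false
set_option linter.dupNamespace false

namespace Summit.QuantumAdvantage.QuantumAdvantage.Theorems.PartyDial

open Finset
open Summit.QuantumAdvantage.AdviceFreeQNC0

/-! ## §3  The laws (two blocks `8/9`, four blocks `2/3`) and the pieces of `FrobHardOdd` -/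

section Laws

variable {n : ℕ}

/-- `γ(m₀) = (1 − 2/2^{m₀})/3`: the guaranteed fraction of each weight class of a block of length `≥ m₀`. -/
noncomputable def gam (m₀ : ℕ) : ℝ := (1 - 2 / (2 : ℝ) ^ m₀) / 3

/-- `γ(m₀) ≥ 0` for `m₀ ≥ 1`. -/
theorem gam_nonneg {m₀ : ℕ} (hm₀ : 1 ≤ m₀) : 0 ≤ gam m₀ := by
  unfold gam
  have h2 : (2 : ℝ) ≤ 2 ^ m₀ := by
    calc (2 : ℝ) = 2 ^ 1 := by norm_num
      _ ≤ 2 ^ m₀ := pow_le_pow_right₀ (by norm_num) hm₀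
  have : 2 / (2 : ℝ) ^ m₀ ≤ 1 := by
    rw [div_le_one (by positivity)]; exact h2
  linarith

/-- **The block law.**  If every profile of class-tables of the `k`-party table game wins at most `N`
cells, then EVERY `k`-block-local strategy (blocks of length `≥ m₀ ≥ 1`, arbitrary functions of their
blocks, any per-cut charges) wins on at most `(1 − (3^k − N)·γ(m₀)^k)·2ⁿ` inputs. -/
theorem block_law (k N : ℕ) (hN : ∀ t : Fin k → ZMod 3 → Fin 4, nWins t ≤ N)
    {G : Type*} [Fintype G] {bl : Fin n → ℕ} (pos : G → ℕ) {pty : G → ℕ} (e : G → ℕ)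
    (y : G → (Fin n → Bool) → Bool)
    (hblk : ∀ i, bl i < k) (hpty : ∀ g, pty g < k)
    (hpast : ∀ (i : Fin n) (g : G), bl i < pty g → i.val < pos g)
    (hfut : ∀ (i : Fin n) (g : G), pty g < bl i → pos g ≤ i.val)
    (hy : ∀ g, BlockLocal bl (pty g) (y g))
    {m₀ : ℕ} (hm₀ : 1 ≤ m₀) (hsize : ∀ j < k, m₀ ≤ (univ.filter fun i : Fin n => bl i = j).card) :
    ((univ.filter fun u : Fin n → Bool => ringWinE pos e y u = true).card : ℝ) ≤
      (1 - ((3 : ℝ) ^ k - N) * gam m₀ ^ k) * (2 : ℝ) ^ n := by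
  classical
  have hγ : ∀ j < k, ∀ r : ZMod 3, gam m₀ * (2 : ℝ) ^ n ≤
      ((univ.filter fun u : Fin n → Bool => cl bl j u = r).card : ℝ) := by
    intro j hj r
    rw [card_cl_eq]
    exact SumCodeZero.gamma_mul_le_card_cls j (hsize j hj) r.val (ZMod.val_lt r)
  have hloss := pattern_law k N hN (pat bl pos pty e y) (blockLocal_pat (pos := pos) (e := e) hy)
    (fun _ => gam m₀) (fun _ _ => gam_nonneg hm₀) hγ
  rw [prod_const, card_range, ← filter_lose_eq_loses hblk hpty hpast hfut] at hloss
  have hsplit := card_filter_add_card_filter_not (s := (univ : Finset (Fin n → Bool)))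
    (fun u : Fin n → Bool => ringWinE pos e y u = true)
  simp only [card_univ, Fintype.card_fun, Fintype.card_bool, Fintype.card_fin, Bool.not_eq_true] at hsplit
  have hs : (((univ.filter fun u : Fin n → Bool => ringWinE pos e y u = true).card : ℕ) : ℝ) +
      (((univ.filter fun u : Fin n → Bool => ringWinE pos e y u = false).card : ℕ) : ℝ) = (2 : ℝ) ^ n := by
    exact_mod_cast hsplit
  linarith

/-- a strategy is `k`-BLOCK-LOCAL with blocks of length `≥ m₀`: some block map / party map under which
every cut reads only its own block, earlier blocks lying before it and later blocks after it. -/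
def IsBlockLocal (k m₀ : ℕ) (y : Fin (n + 1) → (Fin n → Bool) → Bool) : Prop :=
  ∃ (bl : Fin n → ℕ) (pty : Fin (n + 1) → ℕ), (∀ i, bl i < k) ∧ (∀ g, pty g < k) ∧
    (∀ (i : Fin n) (g : Fin (n + 1)), bl i < pty g → i.val < g.val) ∧
    (∀ (i : Fin n) (g : Fin (n + 1)), pty g < bl i → g.val ≤ i.val) ∧
    (∀ g, BlockLocal bl (pty g) (y g)) ∧ (∀ j < k, m₀ ≤ (univ.filter fun i : Fin n => bl i = j).card)

/-- **TWO-BLOCK LAW** (`8/9`): a 2-block-local strategy wins on at most `(1 − γ(m₀)²)·2ⁿ ≈ (8/9)·2ⁿ`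
inputs — every `n`, every charge, no degree hypothesis. -/
theorem twoBlockLaw {m₀ : ℕ} (hm₀ : 1 ≤ m₀) (c : ℕ) (y : Fin (n + 1) → (Fin n → Bool) → Bool)
    (hy : IsBlockLocal 2 m₀ y) :
    ((univ.filter fun u : Fin n → Bool => ringWinU c y u = true).card : ℝ) ≤
      (1 - gam m₀ ^ 2) * (2 : ℝ) ^ n := by
  obtain ⟨bl, pty, hblk, hpty, hpast, hfut, hloc, hsize⟩ := hy
  have h := block_law 2 8 nWins_two_le (fun g : Fin (n + 1) => g.val) (fun g => c + g.val) y hblk hpty hpast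
    hfut hloc hm₀ hsize
  norm_num at h
  exact h

/-- **FOUR-BLOCK LAW** (`2/3`, from the kernel check `Best4Le`): a 4-block-local strategy wins on at most
`(1 − 27·γ(m₀)⁴)·2ⁿ ≈ (2/3)·2ⁿ` inputs — the optimal constant (one blind cut wins `2/3`). -/
theorem fourBlockLaw (hB : Best4Le) {m₀ : ℕ} (hm₀ : 1 ≤ m₀) (c : ℕ)
    (y : Fin (n + 1) → (Fin n → Bool) → Bool) (hy : IsBlockLocal 4 m₀ y) :
    ((univ.filter fun u : Fin n → Bool => ringWinU c y u = true).card : ℝ) ≤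
      (1 - 27 * gam m₀ ^ 4) * (2 : ℝ) ^ n := by
  obtain ⟨bl, pty, hblk, hpty, hpast, hfut, hloc, hsize⟩ := hy
  have h := block_law 4 54 (nWins_four_le_of hB) (fun g : Fin (n + 1) => g.val) (fun g => c + g.val) y hblk
    hpty hpast hfut hloc hm₀ hsize
  norm_num at h
  exact h

/-! ### The pieces of `CharDial.FrobHardOdd` -/

/-- piece (A), the TWO-BLOCK sector: `FrobHardOdd` restricted to degree-`(p−1)` strategies that are
2-block-local with blocks of length `≥ 6`.  [PROVED for every `n` with `θ = 1 − γ(6)²`, the degree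
hypothesis unused: `twoBlockFrobOdd_holds`; strictly WEAKER than T] -/
def TwoBlockFrobOdd : Prop :=
  ∀ (p : ℕ) [Fact p.Prime], 5 ≤ p → ∃ θ : ℝ, θ < 1 ∧ ∃ n₀ : ℕ, ∀ n ≥ n₀, ∀ c : ℕ,
    ∀ y : Fin (n + 1) → (Fin n → Bool) → Bool, (∀ g, HasDegF p (y g) (p - 1)) → IsBlockLocal 2 6 y →
      ((univ.filter fun u : Fin n → Bool => ringWinU c y u = true).card : ℝ) ≤ θ * (2 : ℝ) ^ n

/-- piece (B), the CROSSING residual: `FrobHardOdd` restricted to degree-`(p−1)` strategies that are NOT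
2-block-local (blocks `≥ 6`): some cut reads both sides of every balanced split.  [T-implied:
`crossingFrobOdd_of_frobHardOdd`; UNDECIDED; `⟺ FrobHardOdd`: `frobHardOdd_iff_crossing`] -/
def CrossingFrobOdd : Prop :=
  ∀ (p : ℕ) [Fact p.Prime], 5 ≤ p → ∃ θ : ℝ, θ < 1 ∧ ∃ n₀ : ℕ, ∀ n ≥ n₀, ∀ c : ℕ,
    ∀ y : Fin (n + 1) → (Fin n → Bool) → Bool, (∀ g, HasDegF p (y g) (p - 1)) → ¬ IsBlockLocal 2 6 y →
      ((univ.filter fun u : Fin n → Bool => ringWinU c y u = true).card : ℝ) ≤ θ * (2 : ℝ) ^ n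

/-- `γ(6)² > 0` (numeric). -/
theorem gam_six_sq_pos : 0 < gam 6 ^ 2 := by unfold gam; norm_num

/-- piece (A) holds outright. -/
theorem twoBlockFrobOdd_holds : TwoBlockFrobOdd := by
  intro p _ _
  refine ⟨1 - gam 6 ^ 2, by linarith [gam_six_sq_pos], 0, fun n _ c y _ hy => ?_⟩
  exact twoBlockLaw (by norm_num) c y hy

/-- T ⟹ (B) (projection). -/
theorem crossingFrobOdd_of_frobHardOdd
    (hT : Summit.QuantumAdvantage.QuantumAdvantage.Theses.CharDial.FrobHardOdd) : CrossingFrobOdd := by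
  intro p _ hp
  obtain ⟨θ, hθ, n₀, h⟩ := hT p hp
  exact ⟨θ, hθ, n₀, fun n hn c y hy _ => h n hn c y hy⟩

/-- ★★ item 32598 from its CROSSING residual alone. -/
theorem frobHardOdd_of_crossing (hB : CrossingFrobOdd) :
    Summit.QuantumAdvantage.QuantumAdvantage.Theses.CharDial.FrobHardOdd := by
  intro p _ hp
  obtain ⟨θ₂, hθ₂, n₂, h₂⟩ := hB p hp
  refine ⟨max (1 - gam 6 ^ 2) θ₂, max_lt (by linarith [gam_six_sq_pos]) hθ₂, n₂, fun n hn c y hy => ?_⟩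
  have h2 : (0 : ℝ) ≤ (2 : ℝ) ^ n := by positivity
  by_cases hS : IsBlockLocal 2 6 y
  · exact (twoBlockLaw (by norm_num) c y hS).trans (mul_le_mul_of_nonneg_right (le_max_left _ _) h2)
  · exact (h₂ n hn c y hy hS).trans (mul_le_mul_of_nonneg_right (le_max_right _ _) h2)

/-- **The dial on T**: `FrobHardOdd ⟺ CrossingFrobOdd` (the two-block sector is decided). -/
theorem frobHardOdd_iff_crossing :
    Summit.QuantumAdvantage.QuantumAdvantage.Theses.CharDial.FrobHardOdd ↔ CrossingFrobOdd :=
  ⟨crossingFrobOdd_of_frobHardOdd, frobHardOdd_of_crossing⟩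

end Laws

end Summit.QuantumAdvantage.QuantumAdvantage.Theorems.PartyDial
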